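import Mathlib
import HarnessLib

/-!
# `ν`-th powers of linear forms descend along relatively `p`-radically closed field extensions

Route `ResolutionOfSingularities/WeightedInvariant`, door crux `HypersurfaceCentreConstruction`
(stmt-ResolutionOfSingularities-19897) — OURS, helper; e-ladder `e = 1`, piece **(o25-δ)** «separable base change of
the Abramovich–Quek–Schober centre in the kernel» (res-D-pv-025 AS stub-10; CHAIN w43 v4.18 (3)), brick **(δ0)**: the
elementary algebra by which a tangent ν-fold line (case (B) of the lex-max certificate) or a preparing steepening
`y ↦ y - λ x^b` (case (D)) found over the BIGGER residue field `κ′ = κ(η′)` is already defined over `κ = κ(η)`, as soon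
as `κ` is relatively `p`-radically closed in `κ′` (`y ∈ κ′`, `y^p ∈ κ ⇒ y ∈ κ`; for `κ′/κ` formally smooth this is
`AQSBaseChange.mem_range_algebraMap_of_pow_mem`, file `…AQSBaseChangeResidueField`).  Pure field arithmetic, no
geometry:

* `natCast_choose_pow_ne_zero` — for `1 ≤ ν` there is a prime power `p^m ≤ ν` (`ν = p^m · s`, `p ∤ s`) with
  `(ν.choose (p^m) : K) ≠ 0` in exponential characteristic `p` (Lucas: `choose (p^m s) (p^m) ≡ s (mod p)`);
* `mem_range_of_forall_choose_mul_pow_mem` — if `c ≠ 0` and every `c · C(ν,k) · μ^k` (`k ≤ ν`) lies in `κ`, then `μ`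
  and `c` lie in `κ` (the coefficient `k = p^m` gives `μ^{p^m} ∈ κ`);
* `exists_descent_of_forall_choose_mul_pow_mul_pow_mem` — if every coefficient `c · C(ν,k) · α^k β^{ν-k}` of the
  binary form `c (αX + βY)^ν` over `κ′` lies in `κ` (and `c ≠ 0`, `(α, β) ≠ 0`), the same coefficients are those of a
  form `c₀ (α₀X + β₀Y)^ν` with `c₀, α₀, β₀ ∈ κ`, `c₀ ≠ 0`.

Def-free; no named facts; nothing here is a claim about Hironaka's problem. AI-written; weaker than expert review.
-/

noncomputable section

set_option linter.dupNamespace false -- mandated namespace of this single-conjunct summit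

namespace Summit.ResolutionOfSingularities.ResolutionOfSingularities.Theorems.AQSBaseChange

universe u v

variable {κ : Type u} {K : Type v} [Field κ] [Field K] [Algebra κ K]

/-! ## A binomial coefficient that survives in characteristic `p` -/

/-- For `1 ≤ ν` there is a prime power `p ^ m ≤ ν` of the exponential characteristic with `C(ν, p^m) ≠ 0` in `K`
(write `ν = p^m · s` with `p ∤ s`; Lucas' congruence `C(p^m s, p^m) ≡ s (mod p)`; for `p = 1` take `m = 0`).
[folklore] -/
theorem natCast_choose_pow_ne_zero (p : ℕ) [ExpChar K p] {ν : ℕ} (hν : 1 ≤ ν) :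
    ∃ m : ℕ, p ^ m ≤ ν ∧ ((ν.choose (p ^ m) : ℕ) : K) ≠ 0 := by
  rcases ‹ExpChar K p› with _ | ⟨hprime⟩
  · haveI := charZero_of_expChar_one' (R := K)
    refine ⟨0, by simpa using hν, ?_⟩
    rw [pow_zero, Nat.choose_one_right, Nat.cast_ne_zero]
    omega
  · haveI : Fact p.Prime := ⟨hprime⟩
    obtain ⟨m, s, hs, hνs⟩ := Nat.exists_eq_pow_mul_and_not_dvd (by omega : ν ≠ 0) p hprime.one_lt.ne'
    have hs0 : s ≠ 0 := by rintro rfl; exact hs (dvd_zero p)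
    refine ⟨m, ?_, ?_⟩
    · rw [hνs]
      exact Nat.le_mul_of_pos_right _ (Nat.pos_of_ne_zero hs0)
    · intro h0
      rw [CharP.cast_eq_zero_iff K p] at h0
      have hmod : (p ^ m * s).choose (p ^ m * 1) ≡ s.choose 1 [MOD p] :=
        Choose.choose_pow_mul_pow_mul_modEq_choose_nat
      rw [mul_one, Nat.choose_one_right, ← hνs] at hmod
      exact hs ((hmod.dvd_iff dvd_rfl).mp h0)

/-! ## Descent of `c · (μ X + Y)^ν` and of `c · (α X + β Y)^ν` -/

/-- Iterating relative `p`-radical closedness: `y ^ (p ^ n) ∈ κ ⇒ y ∈ κ`. [folklore] -/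
theorem mem_range_of_pow_pow_mem (p : ℕ)
    (hcl : ∀ y : K, y ^ p ∈ (algebraMap κ K).range → y ∈ (algebraMap κ K).range) (n : ℕ) {y : K}
    (hy : y ^ (p ^ n) ∈ (algebraMap κ K).range) : y ∈ (algebraMap κ K).range := by
  induction n generalizing y with
  | zero => simpa using hy
  | succ n ih =>
    apply ih
    apply hcl
    rwa [← pow_mul, ← pow_succ]

/-- **Descent of a `ν`-fold linear factor.**  Let `κ ⊆ K` be relatively `p`-radically closed (`p` the exponential
characteristic), `1 ≤ ν`, `c ≠ 0` and `μ` in `K`.  If all the coefficients `c · C(ν,k) · μ^k` (`k ≤ ν`) of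
`c · (μ X + Y)^ν` lie in `κ`, then `μ ∈ κ` and `c ∈ κ`: the coefficient `k = 0` is `c`, and the coefficient
`k = p^m` (`C(ν, p^m) ≠ 0`) gives `μ^{p^m} ∈ κ`. [folklore] -/
theorem mem_range_of_forall_choose_mul_pow_mem (p : ℕ) [ExpChar K p]
    (hcl : ∀ y : K, y ^ p ∈ (algebraMap κ K).range → y ∈ (algebraMap κ K).range)
    {ν : ℕ} (hν : 1 ≤ ν) {c μ : K} (hc : c ≠ 0)
    (h : ∀ k ≤ ν, c * (ν.choose k : K) * μ ^ k ∈ (algebraMap κ K).range) :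
    μ ∈ (algebraMap κ K).range ∧ c ∈ (algebraMap κ K).range := by
  have hc' : c ∈ (algebraMap κ K).range := by simpa using h 0 (Nat.zero_le ν)
  refine ⟨?_, hc'⟩
  obtain ⟨m, hmν, hC⟩ := natCast_choose_pow_ne_zero (K := K) p hν
  obtain ⟨a, ha⟩ := h (p ^ m) hmν
  obtain ⟨c₀, hc₀⟩ := hc'
  -- `μ ^ (p ^ m) = a / (c₀ · C(ν, p^m))` lies in `κ`
  have hμ : μ ^ (p ^ m) ∈ (algebraMap κ K).range := by
    refine ⟨a / (c₀ * (ν.choose (p ^ m) : κ)), ?_⟩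
    rw [map_div₀, map_mul, map_natCast, hc₀, ha]
    field_simp
  exact mem_range_of_pow_pow_mem p hcl m hμ

/-- **Descent of a `ν`-th power of a linear form.**  With `κ ⊆ K` relatively `p`-radically closed, `1 ≤ ν`,
`c ≠ 0` and `(α, β) ≠ (0, 0)` in `K`: if every coefficient `c · C(ν,k) · α^k · β^{ν-k}` (`k ≤ ν`) of the binary
form `c · (α X + β Y)^ν` lies in `κ`, then these coefficients are those of a form `c₀ · (α₀ X + β₀ Y)^ν` with
`c₀ ≠ 0`, `α₀`, `β₀` in `κ` (normalise by `β` — or by `α` if `β = 0` — and apply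
`mem_range_of_forall_choose_mul_pow_mem`). [folklore] -/
theorem exists_descent_of_forall_choose_mul_pow_mul_pow_mem (p : ℕ) [ExpChar K p]
    (hcl : ∀ y : K, y ^ p ∈ (algebraMap κ K).range → y ∈ (algebraMap κ K).range)
    {ν : ℕ} (hν : 1 ≤ ν) {c α β : K} (hc : c ≠ 0) (hαβ : α ≠ 0 ∨ β ≠ 0)
    (h : ∀ k ≤ ν, c * (ν.choose k : K) * α ^ k * β ^ (ν - k) ∈ (algebraMap κ K).range) :
    ∃ c₀ α₀ β₀ : κ, c₀ ≠ 0 ∧ ∀ k ≤ ν,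
      algebraMap κ K (c₀ * (ν.choose k : κ) * α₀ ^ k * β₀ ^ (ν - k)) =
        c * (ν.choose k : K) * α ^ k * β ^ (ν - k) := by
  by_cases hβ : β = 0
  · -- only the coefficient of `X^ν` survives
    subst hβ
    have hα : α ≠ 0 := hαβ.resolve_right (fun h => h rfl)
    obtain ⟨c₀, hc₀⟩ : c * α ^ ν ∈ (algebraMap κ K).range := by
      simpa using h ν le_rfl
    refine ⟨c₀, 1, 0, ?_, fun k hk => ?_⟩
    · rintro rfl
      rw [map_zero] at hc₀
      exact (mul_ne_zero hc (pow_ne_zero ν hα)) hc₀.symm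
    · rcases hk.lt_or_eq with hlt | rfl
      · rw [zero_pow (Nat.sub_ne_zero_of_lt hlt), zero_pow (Nat.sub_ne_zero_of_lt hlt), mul_zero, mul_zero,
          map_zero]
      · simp [hc₀]
  · -- normalise by `β`: `c (αX + βY)^ν = (c β^ν) ((α/β) X + Y)^ν`
    have hcβ : c * β ^ ν ≠ 0 := mul_ne_zero hc (pow_ne_zero ν hβ)
    have h' : ∀ k ≤ ν, c * β ^ ν * (ν.choose k : K) * (α / β) ^ k ∈ (algebraMap κ K).range := by
      intro k hk
      have hk' : c * β ^ ν * (ν.choose k : K) * (α / β) ^ k = c * (ν.choose k : K) * α ^ k * β ^ (ν - k) := by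
        rw [div_pow]
        have hβk : β ^ k ≠ 0 := pow_ne_zero k hβ
        field_simp
        rw [show β ^ ν = β ^ k * β ^ (ν - k) from by rw [← pow_add, Nat.add_sub_cancel' hk]]
        ring
      rw [hk']
      exact h k hk
    obtain ⟨⟨μ₀, hμ₀⟩, ⟨c₁, hc₁⟩⟩ := mem_range_of_forall_choose_mul_pow_mem p hcl hν hcβ h'
    refine ⟨c₁, μ₀, 1, ?_, fun k hk => ?_⟩
    · rintro rfl
      rw [map_zero] at hc₁
      exact hcβ hc₁.symm
    · rw [map_mul, map_mul, map_mul, map_pow, map_pow, map_one, one_pow, mul_one, map_natCast, hc₁, hμ₀,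
        div_pow]
      have hβk : β ^ k ≠ 0 := pow_ne_zero k hβ
      field_simp
      rw [show β ^ ν = β ^ k * β ^ (ν - k) from by rw [← pow_add, Nat.add_sub_cancel' hk]]
      ring

end Summit.ResolutionOfSingularities.ResolutionOfSingularities.Theorems.AQSBaseChange

end
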